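import Summits.AtomisticToContinuum.FouriersLaw.Theorems.JunctionLocalityNonBallisticDrudeLineDefs
import Summits.AtomisticToContinuum.FouriersLaw.Theorems.JunctionLocalityNonBallisticStubAutocorrelationContinuous
import Summits.AtomisticToContinuum.FouriersLaw.Theorems.JunctionLocalityNonBallisticStubTimeIntegratedCurrentVarianceContinuityAux2
import Summits.AtomisticToContinuum.FouriersLaw.Theorems.BondHeatUncertaintyLinearResponseFTURBondHeatVarianceContinuityHelper5
import Summits.AtomisticToContinuum.FouriersLaw.Theorems.BondHeatUncertaintyLinearResponseFTUREquilibriumBondHeatVariance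
import Summits.AtomisticToContinuum.FouriersLaw.Theorems.BondHeatUncertaintySubdiffusiveBondHeatBathBondReductionVariance
import Literature.MathematicalPhysics.KineticTheory.LangevinChainEnergyIdentity

/-!
# Stub `stub_timeIntegratedCurrentVarianceContinuity` of line `drude-controls-conductance` (R1) —
# crux `JunctionLocality.NonBallistic` (stmt-AtomisticToContinuum-9127): δ-continuity of the variance of the
# time-integrated total current along the NESS family

Target: `Summits/AtomisticToContinuum/FouriersLaw/Theorems/JunctionLocalityNonBallisticStubTimeIntegratedCurrentVarianceContinuity.lean`.
The registered stub (= `DrudeLine.TimeIntegratedCurrentVarianceContinuity`, part 3 of the lead's split of the lever):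
under weak-NESS uniqueness and along a steady-state family `μ`, for `T > 0`, `N ≥ 2` and `t > 0`, the time-integrated
total current `Φ_t(z, w) = ∫₀ᵗ J_tot(Φ_s(z, B(w))) ds` (`DrudeLine.timeIntegratedCurrent`, `J_tot = totalCurrentObs = Σ_i j_i`)
is square integrable under `μ_δ ⊗ W`, `μ_δ = μ N (T+δ/2) (T-δ/2)`, for all small `δ`, and
`Var_δ(Φ_t) → Var_0(Φ_t)` as `δ → 0`, `δ ≠ 0`, the limit being the variance along the equal-temperature member `μ N T T`.

This is the total-current twin of the landed K6b `LinearResponseFTUR.stub_bondHeatVarianceContinuity` (bond current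
`j_b` ↦ total current `J_tot`, the `Obs`-coordinate `Q^b` of the flux law ↦ the path functional `Φ_t` on `μ_δ ⊗ W`
directly), and the proof is K6b's step by step:
* on the box `|δ| ≤ T`, `μ_δ` is a kernel-invariant probability measure (`BondHeatUncertainty.ness_facts`) with
  `∫ e^{H/(2T)} dμ_δ ≤ M` uniformly (`LinearResponseFTUR.ness_uniform_exp_moment`), and `J_tot` is continuous of
  exponential class `|J_tot| ≤ C e^{H/(8T)}` (`pinnedChain_abs_totalBondCurrent_le_exp`), so `J_tot² ∈ L¹(μ_δ)` with
  `∫ J_tot² dμ_δ ≤ C²M`;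
* the variance is the kernel-level quantity `2∫₀ᵗ (t-r) ∫ J_tot·(P^δ_r J_tot) dμ_δ dr - (t μ_δ(J_tot))²`
  (`variance_timeIntegral_of_invariant`: second moment by the GENERAL
  `SubdiffusiveBondHeat.pinnedChain_integral_sq_intervalIntegral_of_invariant`, mean by
  `LinearResponseFTUR.EquilibriumBondHeatVariance.pinnedChain_integral_intervalIntegral_of_invariant`,
  `Var = E X² - (E X)²`);
* the mean term converges by `LinearResponseFTUR.ness_tendsto_integral_of_growth` (general dominated observable);
* for every lag `r`, `∫ J_tot·(P^δ_r J_tot) dμ_δ → ∫ J_tot·(P^0_r J_tot) dμ_T` (Aux 2 `nessTendstoObsPairing`, the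
  observable-agnostic re-run of K6b's Helpers 7–8), with the uniform bound `|∫ J·(P^δ_r J) dμ_δ| ≤ 2∫ J² dμ_δ ≤ 2C²M`
  (`SubdiffusiveBondHeat.pinnedChain_abs_kernelPairing_le`), so dominated convergence in `r` concludes.
-/

noncomputable section

namespace Summit.AtomisticToContinuum.FouriersLaw.Theorems.NonBallistic

open MeasureTheory ProbabilityTheory Filter Topology Set
open scoped NNReal ENNReal Topology BigOperators
open Literature.MathematicalPhysics.KineticTheory
open Literature.MathematicalPhysics.KineticTheory.HeatConduction
open Literature.Probability.Process OscillatorChain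
open Summit.AtomisticToContinuum.FouriersLaw.Theorems.BondHeatUncertainty
open Summit.AtomisticToContinuum.FouriersLaw.Theorems.SubdiffusiveBondHeat
open Summit.AtomisticToContinuum.FouriersLaw.Theorems.LinearResponseFTUR
open Summit.AtomisticToContinuum.FouriersLaw.Theorems.JunctionLocality
open Summit.AtomisticToContinuum.FouriersLaw.Theorems.NonBallistic.DrudeLine

section Flow

variable {ω₂ lam β γ : ℝ} (hω : 0 < ω₂) (hl : 0 ≤ lam) (hβ : 0 ≤ β) (hγ : 0 ≤ γ) (N : ℕ) (a b : ℝ)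
include hω hl hβ hγ

/-- A time integral of a continuous observable along the constructed flow is jointly measurable in the start and
the driving pair (copy of the private lemma of K6b's Helper 9). [folklore] -/
private theorem measurable_timeIntegral' {f : PhaseSpace N → ℝ} (hf : Continuous f) (t : ℝ) :
    Measurable fun p : PhaseSpace N × WienerPair =>
      ∫ s in (0:ℝ)..t, f ((pinnedChain ω₂ lam β γ).solMap N a b s p.1 (pairPath p.2)) := by
  refine measurable_intervalIntegral_of_continuous_of_measurable (fun p => ?_) (fun s => ?_) t
  · exact hf.comp (pinnedChain_continuous_solMap hω hl hβ hγ N a b p.1 (pairPath p.2))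
  · exact hf.measurable.comp (pinnedChain_measurable_solMap_pairPath hω hl hβ hγ N a b s)

/-- **The variance of a time integral along the stationary flow is a kernel-level quantity** (the general-observable
form of K6b's Helper 9, without the flux-law transport): for the pinned chain (`ω₂ > 0`, `lam, β, γ ≥ 0`), a probability
law `μ` invariant under the constructed kernels at `(a, b)`, a continuous `f` with `f² ∈ L¹(μ)` and `t ≥ 0`, the path
functional `X_t = ∫₀ᵗ f(Φ_s(z, B(w))) ds` is in `L²(μ ⊗ W)` and
`Var(X_t) = 2∫₀ᵗ (t - r) ∫ f·(P_r f) dμ dr - (t μ(f))²`. [folklore] -/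
private theorem variance_timeIntegral_of_invariant (μ : Measure (PhaseSpace N)) [IsProbabilityMeasure μ]
    (hinv : ∀ s : ℝ≥0, μ.bind ((pinnedChain ω₂ lam β γ).transitionKernel N a b s) = μ)
    {f : PhaseSpace N → ℝ} (hf : Continuous f) (hf2 : Integrable (fun y => f y ^ 2) μ) {t : ℝ} (ht : 0 ≤ t) :
    MemLp (fun p : PhaseSpace N × WienerPair =>
        ∫ s in (0:ℝ)..t, f ((pinnedChain ω₂ lam β γ).solMap N a b s p.1 (pairPath p.2))) 2 (μ.prod wienerPair) ∧
    variance (fun p : PhaseSpace N × WienerPair =>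
        ∫ s in (0:ℝ)..t, f ((pinnedChain ω₂ lam β γ).solMap N a b s p.1 (pairPath p.2))) (μ.prod wienerPair) =
      2 * (∫ r in (0:ℝ)..t, (t - r) * ∫ y, f y *
          (∫ y', f y' ∂((pinnedChain ω₂ lam β γ).transitionKernel N a b r.toNNReal y)) ∂μ) -
        (t * ∫ y, f y ∂μ) ^ 2 := by
  set P := pinnedChain ω₂ lam β γ with hP
  have hfm : Measurable f := hf.measurable
  set Q : PhaseSpace N × WienerPair → ℝ := fun p => ∫ s in (0:ℝ)..t, f (P.solMap N a b s p.1 (pairPath p.2)) with hQ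
  have hQm : Measurable Q := measurable_timeIntegral' hω hl hβ hγ N a b hf t
  -- square integrability of `Q`
  have hQQ := pinnedChain_integrable_intervalIntegral_mul_of_invariant hω hl hβ hγ N a b μ hinv hfm hfm hf2 hf2 ht
  have hQ2 : Integrable (fun p => Q p ^ 2) (μ.prod wienerPair) :=
    hQQ.congr (Eventually.of_forall fun p => by simp only [hQ]; ring)
  have hmem : MemLp Q 2 (μ.prod wienerPair) := (memLp_two_iff_integrable_sq hQm.aestronglyMeasurable).2 hQ2
  refine ⟨hmem, ?_⟩
  rw [variance_eq_sub hmem]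
  -- the second moment
  have hE2 : ∫ p, (Q ^ 2) p ∂(μ.prod wienerPair) = 2 * ∫ r in (0:ℝ)..t, (t - r) *
      ∫ y, f y * (∫ y', f y' ∂(P.transitionKernel N a b r.toNNReal y)) ∂μ := by
    have h := pinnedChain_integral_sq_intervalIntegral_of_invariant hω hl hβ hγ N a b μ hinv hfm hf2 ht
    simpa only [Pi.pow_apply] using h
  -- the mean: Fubini and the one-time law
  have hE1 : ∫ p, Q p ∂(μ.prod wienerPair) = t * ∫ y, f y ∂μ :=
    EquilibriumBondHeatVariance.pinnedChain_integral_intervalIntegral_of_invariant hω hl hβ hγ N a b μ hinv hfm hf2 ht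
  rw [hE2, hE1]

end Flow

/-- **Stub `stub_timeIntegratedCurrentVarianceContinuity`** (= `DrudeLine.TimeIntegratedCurrentVarianceContinuity`,
part 3 of the lead's split of the lever of line `drude-controls-conductance`; the total-current twin of the landed K6b
`LinearResponseFTUR.stub_bondHeatVarianceContinuity`): for the pinned chain (all parameters `> 0`), under weak-NESS
uniqueness and along a steady-state family `μ` at `T ± δ/2`, for `T > 0`, `N ≥ 2`, `t > 0`: `Φ_t ∈ L²(μ_δ ⊗ W)` for
all small `δ ≠ 0` and `Var_δ(Φ_t) → Var_0(Φ_t)` as `δ → 0`, `δ ≠ 0`, the limit being the variance along the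
equal-temperature member `μ N T T` (kernel-level variance formula at each `δ`, uniform exponential moments and weak
convergence of the NESS family — K6b's Helpers 1–5 —, δ-continuity of the pairing `∫ J_tot (P^δ_r J_tot) dμ_δ` at every
lag — Aux 1–2 —, dominated convergence in the lag). [folklore] -/
theorem stub_timeIntegratedCurrentVarianceContinuity :
    ∀ ω₂ lam β γ : ℝ, 0 < ω₂ → 0 < lam → 0 < β → 0 < γ →
    (∀ (N : ℕ) (T_L T_R : ℝ), 0 < T_L → 0 < T_R → ∀ μ ν : Measure (PhaseSpace N),
      (pinnedChain ω₂ lam β γ).IsSteadyState N T_L T_R μ →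
      (pinnedChain ω₂ lam β γ).IsSteadyState N T_L T_R ν → μ = ν) →
    ∀ μ : (N : ℕ) → ℝ → ℝ → Measure (PhaseSpace N),
      (∀ (N : ℕ) (T_L T_R : ℝ), 0 < T_L → 0 < T_R →
        (pinnedChain ω₂ lam β γ).IsSteadyState N T_L T_R (μ N T_L T_R)) →
    ∀ T : ℝ, 0 < T → ∀ N : ℕ, 2 ≤ N → ∀ t : ℝ, 0 < t →
      (∀ᶠ δ in 𝓝[≠] (0 : ℝ), MemLp (timeIntegratedCurrent (pinnedChain ω₂ lam β γ) N (T + δ / 2) (T - δ / 2) t) 2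
        ((μ N (T + δ / 2) (T - δ / 2)).prod wienerPair)) ∧
      Tendsto (fun δ : ℝ => variance (timeIntegratedCurrent (pinnedChain ω₂ lam β γ) N (T + δ / 2) (T - δ / 2) t)
          ((μ N (T + δ / 2) (T - δ / 2)).prod wienerPair)) (𝓝[≠] 0)
        (𝓝 (variance (timeIntegratedCurrent (pinnedChain ω₂ lam β γ) N T T t) ((μ N T T).prod wienerPair))) := by
  intro ω₂ lam β γ hω hl hβ hγ huniq μ hμ T hT N hN t ht
  set P := pinnedChain ω₂ lam β γ with hP
  set H := P.hamiltonian N with hH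
  have hH0 : ∀ x, 0 ≤ H x := fun x => pinnedChain_hamiltonian_nonneg hω.le hl.le hβ.le γ N x
  -- the total current `J_tot = Σ_i j_i`
  set j : PhaseSpace N → ℝ := totalCurrentObs P N with hj
  have hjsum : j = fun x => ∑ i : Fin N, P.bondCurrent N i x := rfl
  have hjc : Continuous j := by rw [hjsum]; exact pinnedChain_continuous_totalBondCurrent ω₂ lam β γ N
  have hjm : Measurable j := hjc.measurable
  set ϑ : ℝ := 1 / (2 * T) with hϑ
  have hϑ0 : 0 < ϑ := by positivity
  have hϑ4 : ϑ / 4 < 1 / (2 * T) := by rw [hϑ]; exact div_lt_self (by positivity) (by norm_num)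
  obtain ⟨M, hM⟩ := ness_uniform_exp_moment ω₂ lam β γ hω hl hβ hγ huniq μ hμ T hT N hN
  -- the box `|δ| ≤ T`
  have hpos : ∀ δ : ℝ, |δ| ≤ T → 0 < T + δ / 2 ∧ 0 < T - δ / 2 := fun δ hδ => by
    have h := abs_le.1 hδ
    exact ⟨by linarith only [hT, h.1], by linarith only [hT, h.2]⟩
  have hprob : ∀ δ : ℝ, |δ| ≤ T → IsProbabilityMeasure (μ N (T + δ / 2) (T - δ / 2)) := fun δ hδ =>
    (hμ N _ _ (hpos δ hδ).1 (hpos δ hδ).2).1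
  have hinv : ∀ δ : ℝ, |δ| ≤ T → ∀ s : ℝ≥0,
      (μ N (T + δ / 2) (T - δ / 2)).bind (P.transitionKernel N (T + δ / 2) (T - δ / 2) s) =
        μ N (T + δ / 2) (T - δ / 2) := fun δ hδ =>
    (ness_facts ω₂ lam β γ hω hl hβ hγ huniq μ hμ N hN _ _ (hpos δ hδ).1 (hpos δ hδ).2).2.1
  have hzero : |(0 : ℝ)| ≤ T := by simpa using hT.le
  have hbox : ∀ᶠ δ : ℝ in 𝓝[≠] 0, |δ| ≤ T := by
    have h1 : Metric.closedBall (0 : ℝ) T ∈ 𝓝[≠] (0 : ℝ) :=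
      mem_nhdsWithin_of_mem_nhds (Metric.closedBall_mem_nhds 0 hT)
    filter_upwards [h1] with δ hδ1
    simpa [Real.dist_eq] using hδ1
  -- the total current: exponential domination and square integrability on the box
  set Cj : ℝ := N * (N * ((3 + β) / 2) * (2 * Real.exp (ϑ / 4) / (ϑ / 4) ^ 2)) with hCjdef
  have hCj0 : 0 ≤ Cj := by positivity
  have hCj : ∀ x, |j x| ≤ Cj * Real.exp (ϑ / 4 * H x) := fun x => by
    rw [hjsum]
    exact pinnedChain_abs_totalBondCurrent_le_exp hω.le hl.le hβ.le γ N (ϑ := ϑ / 4) (by positivity) x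
  have hj2V : ∀ x, j x ^ 2 ≤ Cj ^ 2 * Real.exp (ϑ * H x) := fun x => by
    have h1 : j x ^ 2 ≤ (Cj * Real.exp (ϑ / 4 * H x)) ^ 2 := by
      rw [← sq_abs]; exact pow_le_pow_left₀ (abs_nonneg _) (hCj x) 2
    refine h1.trans ?_
    rw [mul_pow, ← Real.exp_nat_mul]
    refine mul_le_mul_of_nonneg_left (Real.exp_le_exp.2 ?_) (sq_nonneg _)
    push_cast
    nlinarith only [hH0 x, hϑ0]
  have hj2 : ∀ δ : ℝ, |δ| ≤ T → Integrable (fun y => j y ^ 2) (μ N (T + δ / 2) (T - δ / 2)) ∧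
      ∫ y, j y ^ 2 ∂(μ N (T + δ / 2) (T - δ / 2)) ≤ Cj ^ 2 * M := by
    intro δ hδ
    obtain ⟨hint, hle⟩ := hM δ hδ
    have hi : Integrable (fun y => j y ^ 2) (μ N (T + δ / 2) (T - δ / 2)) :=
      (hint.const_mul (Cj ^ 2)).mono' (hjc.pow 2).aestronglyMeasurable (Eventually.of_forall fun x => by
        rw [Real.norm_eq_abs, abs_of_nonneg (sq_nonneg _)]; exact hj2V x)
    refine ⟨hi, ?_⟩
    calc ∫ y, j y ^ 2 ∂(μ N (T + δ / 2) (T - δ / 2))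
        ≤ ∫ y, Cj ^ 2 * Real.exp (ϑ * H y) ∂(μ N (T + δ / 2) (T - δ / 2)) := integral_mono hi (hint.const_mul _) hj2V
      _ = Cj ^ 2 * ∫ y, Real.exp (ϑ * H y) ∂(μ N (T + δ / 2) (T - δ / 2)) := integral_const_mul _ _
      _ ≤ Cj ^ 2 * M := mul_le_mul_of_nonneg_left hle (sq_nonneg _)
  -- the kernel-level variance formula on the box
  have hV : ∀ δ : ℝ, |δ| ≤ T →
      MemLp (timeIntegratedCurrent P N (T + δ / 2) (T - δ / 2) t) 2 ((μ N (T + δ / 2) (T - δ / 2)).prod wienerPair) ∧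
      variance (timeIntegratedCurrent P N (T + δ / 2) (T - δ / 2) t) ((μ N (T + δ / 2) (T - δ / 2)).prod wienerPair) =
        2 * (∫ r in (0:ℝ)..t, (t - r) * ∫ y, j y * (∫ y', j y'
            ∂(P.transitionKernel N (T + δ / 2) (T - δ / 2) r.toNNReal y)) ∂(μ N (T + δ / 2) (T - δ / 2))) -
          (t * ∫ y, j y ∂(μ N (T + δ / 2) (T - δ / 2))) ^ 2 := by
    intro δ hδ
    haveI := hprob δ hδ
    exact variance_timeIntegral_of_invariant hω hl.le hβ.le hγ.le N _ _ (μ N (T + δ / 2) (T - δ / 2)) (hinv δ hδ)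
      hjc (hj2 δ hδ).1 ht.le
  refine ⟨?_, ?_⟩
  · filter_upwards [hbox] with δ hδ
    exact (hV δ hδ).1
  -- (i) the mean
  have hmean := (ness_tendsto_integral_of_growth ω₂ lam β γ hω hl hβ hγ huniq μ hμ T hT N hN j hjc Cj (ϑ / 4)
    (by positivity) hϑ4 hCj).2
  -- (ii) the lag integral, by dominated convergence
  have hI : Tendsto (fun δ : ℝ => ∫ r in (0:ℝ)..t, (t - r) * ∫ y, j y * (∫ y', j y'
        ∂(P.transitionKernel N (T + δ / 2) (T - δ / 2) r.toNNReal y)) ∂(μ N (T + δ / 2) (T - δ / 2)))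
      (𝓝[≠] 0) (𝓝 (∫ r in (0:ℝ)..t, (t - r) * ∫ y, j y * (∫ y', j y'
        ∂(P.transitionKernel N T T r.toNNReal y)) ∂(μ N T T))) := by
    refine intervalIntegral.tendsto_integral_filter_of_dominated_convergence
      (bound := fun _ => t * (Cj ^ 2 * M + Cj ^ 2 * M)) ?_ ?_ ?_ ?_
    · filter_upwards [hbox] with δ hδ
      haveI := hprob δ hδ
      exact ((continuous_const.sub continuous_id).measurable.mul
        (pinnedChain_measurable_kernelPairing hω hl.le hβ.le hγ.le N _ _ (μ N (T + δ / 2) (T - δ / 2))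
          hjm hjm)).aestronglyMeasurable
    · filter_upwards [hbox] with δ hδ
      haveI := hprob δ hδ
      refine Eventually.of_forall fun r hr => ?_
      rw [Set.uIoc_of_le ht.le] at hr
      have hpair := pinnedChain_abs_kernelPairing_le hω hl.le hβ.le hγ.le N _ _ (μ N (T + δ / 2) (T - δ / 2))
        (hinv δ hδ) hjm hjm (hj2 δ hδ).1 (hj2 δ hδ).1 r
      rw [norm_mul, Real.norm_eq_abs, Real.norm_eq_abs]
      refine mul_le_mul ?_ (hpair.trans (add_le_add (hj2 δ hδ).2 (hj2 δ hδ).2)) (abs_nonneg _) ht.le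
      rw [abs_of_nonneg (by linarith only [hr.2])]
      linarith only [hr.1]
    · exact intervalIntegrable_const
    · refine Eventually.of_forall fun r hr => ?_
      rw [Set.uIoc_of_le ht.le] at hr
      exact (nessTendstoObsPairing ω₂ lam β γ hω hl hβ hγ huniq μ hμ T hT N hN j hjc Cj hCj0 hCj r hr.1.le).const_mul _
  -- (iii) conclusion
  have hlim := (hI.const_mul 2).sub ((hmean.const_mul t).pow 2)
  have hV0 := hV 0 hzero
  simp only [zero_div, add_zero, sub_zero] at hV0
  rw [hV0.2]
  refine hlim.congr' ?_
  filter_upwards [hbox] with δ hδ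
  exact (hV δ hδ).2.symm

end Summit.AtomisticToContinuum.FouriersLaw.Theorems.NonBallistic

end
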